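import Summits.QuantumAdvantage.QuantumAdvantage.Theorems.CubicForrelationNearExactIsExactCubicFormR2PartnerCells
import Summits.QuantumAdvantage.QuantumAdvantage.Theorems.CubicForrelationNearExactIsExactCubicFormPartnerTransport
import Summits.QuantumAdvantage.QuantumAdvantage.Theorems.CubicForrelationNearExactIsExactCubicFormLightCell
import Summits.QuantumAdvantage.QuantumAdvantage.Theorems.CubicForrelationNearExactIsExactCubicFormLightCoordsRead
import Summits.QuantumAdvantage.QuantumAdvantage.Theorems.CubicForrelationNearExactIsExactCubicFormBlockFrame
import Summits.QuantumAdvantage.QuantumAdvantage.Theorems.CubicForrelationNearExactIsExactTwelvePartnerLight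

/-!
# Crux `CubicForrelation.NearExactIsExact` (stmt-QuantumAdvantage-14043) — E1280-even, R2 branch, HYPERPLANE type: the light cell in NORMAL
  COORDINATES (`t̄ = s₀ ∧ ω_{2h}`, supporting hyperplane `{s₀ = b}`), the whole partner package transported along

Certificate seat `b2b-cforr-cert` (gen 42).  HONEST FRAMING: kernel-checked bookkeeping (standard axioms) — it discharges the hypothesis `HHYP`
of `tpw_R2_frame_false_of_branches` (…CubicFormR2PartnerCells) from a per-rank statement `HL h` (`h = 1,2,3,4` ↔ descendants `T`, `s₀ω₄`,
`s₀ω₆`, `s₀ω₈` ↔ light cell of weight `64, 96, 112, 120`): the light cell's frame (`tlc_light_frame`), its coordinates (`tpw_light_coords` =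
`tlc_coords` + the hyperplane read-off `⟨P y, z⟩ = y₀`), the block frame `1₃ ⊕ P` (`tbf_block_frame`), the transport of `(κ, c, d, (PAIR))`
(`tpw_partner_transport`), of the frame identity (`tpw_block_frame_identity`), of `hF1` (`tpw_F1_of_frame_identity`), of the cells and their
weights (`tct_card_comp`), and of the cubic form of the light cell (`tct_third_comp`).  What `HL h` receives: the adapted-frame package on
`3 + 9` bits, the light cell `(i,j)` (minimal, `4w + 2^{9−h} = 2⁹`), its supporting half-space `s₀ = b`, and its third differences
`u₀·ω(v,w) ⊕ v₀·ω(u,w) ⊕ w₀·ω(u,v)` with `ω = Σ_{i<h} s_{1+i} ∧ s_{1+h+i}` (coordinates of `Fin 9` through `Fin.castLE hk`, `hk : 1+h+h ≤ 9`).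
`HL 1..4` remain TO BE PROVED (cell lemmas + leaves `tpa_R2_*`).  Nothing about `θ₁₂`; NOT summit progress.

References: this seat lineage (g37 R2-PARTNER §2–4, g39 HANDPROOFS §1, g40–41 tools, esp. `tlc_coords`).  Axioms: the standard three.
-/

set_option linter.dupNamespace false -- D-0017: single-problem summit ⇒ `QuantumAdvantage.QuantumAdvantage` by design

namespace Summit.QuantumAdvantage.QuantumAdvantage.Theorems.CubicForrelation.NearExactIsExact

open Finset
open Literature.Computability.QuantumComplexity
open Literature.Computability.QuantumComplexity.BuzetChailloux (bxor zeroVec bxor_comm bxor_self bxor_zeroVec zeroVec_bxor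
  bxor_bxor_cancel_left)



/-- **HYPERPLANE TYPE ⇒ per-rank levels.**  Given `HL h` for `h = 1, …, 4` (see the module docstring for what it receives), the hypothesis
`HHYP` of `tpw_R2_frame_false_of_branches` holds: a lightest free cell supported in an affine hyperplane leads to a contradiction.
NOT summit progress: the `HL h` are not yet kernel theorems. [this work] -/
theorem tpw_R2_hyperplane_of_levels
    (HL : ∀ (h : ℕ) (hk : 1 + h + h ≤ 9), 1 ≤ h →
      ∀ (κ : (Fin (3 + 9) → Bool) → Bool), IsDegLeFun 3 κ →
      ∀ (c d : Fin (3 + 9) → Fin (3 + 9) → Fin (3 + 9) → ZMod 2),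
      (∀ p j k, c p k j = c p j k) → (∀ p j k, c j p k = c p j k) → (∀ p j, c p j j = 0) →
      (∀ φ j k, d φ k j = d φ j k) → (∀ φ j k, d j φ k = d φ j k) → (∀ φ j, d φ j j = 0) →
      (∀ φ j k, d φ j k =
        if ((((κ zeroVec ^^ κ (bxor zeroVec (fun l => decide (l = k)))) ^^
                (κ (bxor zeroVec (fun l => decide (l = j))) ^^ κ (bxor (bxor zeroVec (fun l => decide (l = j))) (fun l => decide (l = k))))) ^^
              ((κ (bxor zeroVec (fun l => decide (l = φ))) ^^ κ (bxor (bxor zeroVec (fun l => decide (l = φ))) (fun l => decide (l = k)))) ^^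
                (κ (bxor (bxor zeroVec (fun l => decide (l = φ))) (fun l => decide (l = j))) ^^
                  κ (bxor (bxor (bxor zeroVec (fun l => decide (l = φ))) (fun l => decide (l = j))) (fun l => decide (l = k))))))) = true
        then 1 else 0) →
      (∀ p φ, (∑ j, ∑ k, (if j < k then c p j k * d φ j k else 0)) = if p = φ then 1 else 0) →
      (∀ y, (κ y ^^ κ (bxor y (fun l => decide (l = Fin.castAdd 9 (0 : Fin 3))))) =
        (y (Fin.castAdd 9 (1 : Fin 3)) && y (Fin.castAdd 9 (2 : Fin 3)))) →
      (∀ j k, d (Fin.castAdd 9 0) j k =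
        if (j = Fin.castAdd 9 1 ∧ k = Fin.castAdd 9 2) ∨ (j = Fin.castAdd 9 2 ∧ k = Fin.castAdd 9 1) then 1 else 0) →
      #(univ.filter fun s : Fin 9 → Bool => κ (Fin.append ![false, false, false] s) = true) +
        #(univ.filter fun s : Fin 9 → Bool => κ (Fin.append ![false, false, true] s) = true) +
        #(univ.filter fun s : Fin 9 → Bool => κ (Fin.append ![false, true, false] s) = true) < 384 →
      ∀ (i j : Bool), (i && j) = false →
      (∀ i' j' : Bool, (i' && j') = false →
        #(univ.filter fun s : Fin 9 → Bool => κ (Fin.append ![false, i, j] s) = true) ≤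
          #(univ.filter fun s : Fin 9 → Bool => κ (Fin.append ![false, i', j'] s) = true)) →
      0 < #(univ.filter fun s : Fin 9 → Bool => κ (Fin.append ![false, i, j] s) = true) →
      4 * #(univ.filter fun s : Fin 9 → Bool => κ (Fin.append ![false, i, j] s) = true) + 2 ^ (9 - h) = 2 ^ 9 →
      ∀ (bz : Bool), (∀ s : Fin 9 → Bool, κ (Fin.append ![false, i, j] s) = true → s (Fin.castLE hk (Fin.castAdd h (Fin.castAdd h (0 : Fin 1)))) = bz) →
      (∀ u v w x : Fin 9 → Bool,
        ((((κ (Fin.append ![false, i, j] x) ^^ κ (Fin.append ![false, i, j] (bxor x w))) ^^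
              (κ (Fin.append ![false, i, j] (bxor x v)) ^^ κ (Fin.append ![false, i, j] (bxor (bxor x v) w)))) ^^
            ((κ (Fin.append ![false, i, j] (bxor x u)) ^^ κ (Fin.append ![false, i, j] (bxor (bxor x u) w))) ^^
              (κ (Fin.append ![false, i, j] (bxor (bxor x u) v)) ^^
                κ (Fin.append ![false, i, j] (bxor (bxor (bxor x u) v) w)))))) =
        ((((u (Fin.castLE hk (Fin.castAdd h (Fin.castAdd h (0 : Fin 1)))) &&
            decide ((∑ ii : Fin h, ((if v (Fin.castLE hk (Fin.castAdd h (Fin.natAdd 1 ii))) = true then (1 : ZMod 2) else 0) * (if w (Fin.castLE hk (Fin.natAdd (1 + h) ii)) = true then (1 : ZMod 2) else 0) +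
              (if v (Fin.castLE hk (Fin.natAdd (1 + h) ii)) = true then (1 : ZMod 2) else 0) * (if w (Fin.castLE hk (Fin.castAdd h (Fin.natAdd 1 ii))) = true then (1 : ZMod 2) else 0))) = 1)) ^^
          (v (Fin.castLE hk (Fin.castAdd h (Fin.castAdd h (0 : Fin 1)))) &&
            decide ((∑ ii : Fin h, ((if u (Fin.castLE hk (Fin.castAdd h (Fin.natAdd 1 ii))) = true then (1 : ZMod 2) else 0) * (if w (Fin.castLE hk (Fin.natAdd (1 + h) ii)) = true then (1 : ZMod 2) else 0) +
              (if u (Fin.castLE hk (Fin.natAdd (1 + h) ii)) = true then (1 : ZMod 2) else 0) * (if w (Fin.castLE hk (Fin.castAdd h (Fin.natAdd 1 ii))) = true then (1 : ZMod 2) else 0))) = 1))) ^^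
          (w (Fin.castLE hk (Fin.castAdd h (Fin.castAdd h (0 : Fin 1)))) &&
            decide ((∑ ii : Fin h, ((if u (Fin.castLE hk (Fin.castAdd h (Fin.natAdd 1 ii))) = true then (1 : ZMod 2) else 0) * (if v (Fin.castLE hk (Fin.natAdd (1 + h) ii)) = true then (1 : ZMod 2) else 0) +
              (if u (Fin.castLE hk (Fin.natAdd (1 + h) ii)) = true then (1 : ZMod 2) else 0) * (if v (Fin.castLE hk (Fin.castAdd h (Fin.natAdd 1 ii))) = true then (1 : ZMod 2) else 0))) = 1))))) → False) :
    ∀ (κ : (Fin (3 + 9) → Bool) → Bool), IsDegLeFun 3 κ →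
    ∀ (c d : Fin (3 + 9) → Fin (3 + 9) → Fin (3 + 9) → ZMod 2),
    (∀ p j k, c p k j = c p j k) → (∀ p j k, c j p k = c p j k) → (∀ p j, c p j j = 0) →
    (∀ φ j k, d φ k j = d φ j k) → (∀ φ j k, d j φ k = d φ j k) → (∀ φ j, d φ j j = 0) →
    (∀ φ j k, d φ j k =
      if ((((κ zeroVec ^^ κ (bxor zeroVec (fun l => decide (l = k)))) ^^
              (κ (bxor zeroVec (fun l => decide (l = j))) ^^ κ (bxor (bxor zeroVec (fun l => decide (l = j))) (fun l => decide (l = k))))) ^^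
            ((κ (bxor zeroVec (fun l => decide (l = φ))) ^^ κ (bxor (bxor zeroVec (fun l => decide (l = φ))) (fun l => decide (l = k)))) ^^
              (κ (bxor (bxor zeroVec (fun l => decide (l = φ))) (fun l => decide (l = j))) ^^
                κ (bxor (bxor (bxor zeroVec (fun l => decide (l = φ))) (fun l => decide (l = j))) (fun l => decide (l = k))))))) = true
      then 1 else 0) →
    (∀ p φ, (∑ j, ∑ k, (if j < k then c p j k * d φ j k else 0)) = if p = φ then 1 else 0) →
    (∀ y, (κ y ^^ κ (bxor y (fun l => decide (l = Fin.castAdd 9 (0 : Fin 3))))) =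
      (y (Fin.castAdd 9 (1 : Fin 3)) && y (Fin.castAdd 9 (2 : Fin 3)))) →
    (∀ j k, d (Fin.castAdd 9 0) j k =
      if (j = Fin.castAdd 9 1 ∧ k = Fin.castAdd 9 2) ∨ (j = Fin.castAdd 9 2 ∧ k = Fin.castAdd 9 1) then 1 else 0) →
    #(univ.filter fun s : Fin 9 → Bool => κ (Fin.append ![false, false, false] s) = true) +
      #(univ.filter fun s : Fin 9 → Bool => κ (Fin.append ![false, false, true] s) = true) +
      #(univ.filter fun s : Fin 9 → Bool => κ (Fin.append ![false, true, false] s) = true) < 384 →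
    ∀ (i j : Bool), (i && j) = false →
    (∀ i' j' : Bool, (i' && j') = false →
      #(univ.filter fun s : Fin 9 → Bool => κ (Fin.append ![false, i, j] s) = true) ≤
        #(univ.filter fun s : Fin 9 → Bool => κ (Fin.append ![false, i', j'] s) = true)) →
    0 < #(univ.filter fun s : Fin 9 → Bool => κ (Fin.append ![false, i, j] s) = true) →
    ∀ (z : Fin 9 → Bool) (b : Bool), z ≠ zeroVec →
    (∀ s, κ (Fin.append ![false, i, j] s) = true → decide (Odd #(univ.filter fun l => (s l && z l) = true)) = b) → False := by
  intro κ hκ c d hcs hcc hcd hds hdd hdd' hd hpair hD0 hF1 hsum i j hij hmin hpos z bz hz hsupp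
  obtain ⟨hcub, -, -⟩ := tpw_R2_cells κ hκ d hd hD0
  have hρ := hcub ![false, i, j]
  -- the light cell's frame
  obtain ⟨v, h, bb, cc, hrest⟩ := tlc_light_frame (fun s : Fin 9 → Bool => κ (Fin.append ![false, i, j] s)) hρ z hz bz hsupp
  dsimp only at hrest
  obtain ⟨hvz, -, -, hB, f1, f2, f3, f4, fmax, hbz, hcz, hrad, -, hwt3⟩ := hrest
  -- coordinates
  obtain ⟨hk, P, Pi, hPPi, hPiP, hPz, hform⟩ := tpw_light_coords (fun s : Fin 9 → Bool => κ (Fin.append ![false, i, j] s)) hρ z v bz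
    hsupp hvz (fun x => κ (Fin.append ![false, i, j] x) ^^ κ (Fin.append ![false, i, j] (bxor x v))) (fun x => rfl) _ hB h bb cc
    f1 f2 f3 f4 fmax hbz hcz hrad
  -- the weight of the light cell pins `h`
  have hρlt : #(univ.filter fun s : Fin 9 → Bool => κ (Fin.append ![false, i, j] s) = true) < 128 := by
    have h1 := hmin false false rfl
    have h2 := hmin false true rfl
    have h3 := hmin true false rfl
    omega
  have e1 : 4 * #(univ.filter fun s : Fin 9 → Bool => κ (Fin.append ![false, i, j] s) = true) + 2 ^ (9 - h) = 2 ^ 9 := by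
    rcases hwt3 with e | e | e
    · exact e
    · omega
    · have : 0 < 2 ^ (9 - h) := Nat.two_pow_pos (9 - h)
      omega
  have h1 : 1 ≤ h := by
    rcases Nat.eq_zero_or_pos h with h0 | hp
    · subst h0
      norm_num at e1
      omega
    · exact hp
  -- block frame and transport of the package
  obtain ⟨L, Li, hLLi, hLiL, hLapp, -, hyy, hys, hsy, -⟩ := tbf_block_frame P Pi hPPi hPiP
  obtain ⟨κ', c', d', hκap, -, -, hκ'3, -, hcs', hcc', hcd', hd'T, hpair'⟩ :=
    tpw_partner_transport κ hκ c d hcs hcc hcd hds hdd' hd hpair L Li hLLi hLiL zeroVec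
  have hD0' : ∀ y, (κ' y ^^ κ' (bxor y (fun l => decide (l = Fin.castAdd 9 (0 : Fin 3))))) =
      (y (Fin.castAdd 9 (1 : Fin 3)) && y (Fin.castAdd 9 (2 : Fin 3))) := fun y => by
    rw [hκap, hκap]
    exact tpw_block_frame_identity κ L hyy hys hsy hD0 zeroVec rfl rfl y
  have hF1' := tpw_F1_of_frame_identity κ' d' hd'T hD0'
  obtain ⟨hds', hdc', hdd''⟩ := tpw_d_symm κ' d' hd'T
  -- the cells of `κ'` are the cells of `κ` composed with `P`
  have hcell : ∀ (vv : Fin 3 → Bool) (s : Fin 9 → Bool), κ' (Fin.append vv s) =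
      κ (Fin.append vv (fun σ => decide ((∑ σ', P σ σ' * (if s σ' = true then (1 : ZMod 2) else 0)) = 1))) := by
    intro vv s
    rw [hκap, hLapp vv s, zeroVec_bxor]
  have hW : ∀ i' j' : Bool, #(univ.filter fun s : Fin 9 → Bool => κ' (Fin.append ![false, i', j'] s) = true) =
      #(univ.filter fun s : Fin 9 → Bool => κ (Fin.append ![false, i', j'] s) = true) := by
    intro i' j'
    have e := tct_card_comp P Pi hPPi hPiP zeroVec (fun s : Fin 9 → Bool => κ (Fin.append ![false, i', j'] s) = true)
    simp only [zeroVec_bxor] at e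
    simp only [hcell]
    exact e
  have hsum' : #(univ.filter fun s : Fin 9 → Bool => κ' (Fin.append ![false, false, false] s) = true) +
      #(univ.filter fun s : Fin 9 → Bool => κ' (Fin.append ![false, false, true] s) = true) +
      #(univ.filter fun s : Fin 9 → Bool => κ' (Fin.append ![false, true, false] s) = true) < 384 := by
    rw [hW, hW, hW]; exact hsum
  have hmin' : ∀ i' j' : Bool, (i' && j') = false →
      #(univ.filter fun s : Fin 9 → Bool => κ' (Fin.append ![false, i, j] s) = true) ≤
        #(univ.filter fun s : Fin 9 → Bool => κ' (Fin.append ![false, i', j'] s) = true) := fun i' j' hh => by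
    rw [hW, hW]; exact hmin i' j' hh
  have hpos' : 0 < #(univ.filter fun s : Fin 9 → Bool => κ' (Fin.append ![false, i, j] s) = true) := by rw [hW]; exact hpos
  have hwt' : 4 * #(univ.filter fun s : Fin 9 → Bool => κ' (Fin.append ![false, i, j] s) = true) + 2 ^ (9 - h) = 2 ^ 9 := by
    rw [hW]; exact e1
  -- the supporting hyperplane becomes `s₀ = bz`
  have hsupp' : ∀ s : Fin 9 → Bool, κ' (Fin.append ![false, i, j] s) = true →
      s (Fin.castLE hk (Fin.castAdd h (Fin.castAdd h (0 : Fin 1)))) = bz := by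
    intro s hs
    rw [hcell] at hs
    have e := hsupp _ hs
    rw [hPz s] at e
    exact e
  -- the cubic form of the light cell in the new coordinates
  have hT' : ∀ u v w x : Fin 9 → Bool,
      ((((κ' (Fin.append ![false, i, j] x) ^^ κ' (Fin.append ![false, i, j] (bxor x w))) ^^
            (κ' (Fin.append ![false, i, j] (bxor x v)) ^^ κ' (Fin.append ![false, i, j] (bxor (bxor x v) w)))) ^^
          ((κ' (Fin.append ![false, i, j] (bxor x u)) ^^ κ' (Fin.append ![false, i, j] (bxor (bxor x u) w))) ^^
            (κ' (Fin.append ![false, i, j] (bxor (bxor x u) v)) ^^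
              κ' (Fin.append ![false, i, j] (bxor (bxor (bxor x u) v) w)))))) =
      ((((u (Fin.castLE hk (Fin.castAdd h (Fin.castAdd h (0 : Fin 1)))) &&
            decide ((∑ ii : Fin h, ((if v (Fin.castLE hk (Fin.castAdd h (Fin.natAdd 1 ii))) = true then (1 : ZMod 2) else 0) * (if w (Fin.castLE hk (Fin.natAdd (1 + h) ii)) = true then (1 : ZMod 2) else 0) +
              (if v (Fin.castLE hk (Fin.natAdd (1 + h) ii)) = true then (1 : ZMod 2) else 0) * (if w (Fin.castLE hk (Fin.castAdd h (Fin.natAdd 1 ii))) = true then (1 : ZMod 2) else 0))) = 1)) ^^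
          (v (Fin.castLE hk (Fin.castAdd h (Fin.castAdd h (0 : Fin 1)))) &&
            decide ((∑ ii : Fin h, ((if u (Fin.castLE hk (Fin.castAdd h (Fin.natAdd 1 ii))) = true then (1 : ZMod 2) else 0) * (if w (Fin.castLE hk (Fin.natAdd (1 + h) ii)) = true then (1 : ZMod 2) else 0) +
              (if u (Fin.castLE hk (Fin.natAdd (1 + h) ii)) = true then (1 : ZMod 2) else 0) * (if w (Fin.castLE hk (Fin.castAdd h (Fin.natAdd 1 ii))) = true then (1 : ZMod 2) else 0))) = 1))) ^^
          (w (Fin.castLE hk (Fin.castAdd h (Fin.castAdd h (0 : Fin 1)))) &&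
            decide ((∑ ii : Fin h, ((if u (Fin.castLE hk (Fin.castAdd h (Fin.natAdd 1 ii))) = true then (1 : ZMod 2) else 0) * (if v (Fin.castLE hk (Fin.natAdd (1 + h) ii)) = true then (1 : ZMod 2) else 0) +
              (if u (Fin.castLE hk (Fin.natAdd (1 + h) ii)) = true then (1 : ZMod 2) else 0) * (if v (Fin.castLE hk (Fin.castAdd h (Fin.natAdd 1 ii))) = true then (1 : ZMod 2) else 0))) = 1)))) := by
    intro u v w x
    have h3 := tct_third_comp (fun s : Fin 9 → Bool => κ (Fin.append ![false, i, j] s)) P zeroVec u v w x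
    dsimp only at h3
    simp only [zeroVec_bxor] at h3
    have hf := hform u v w (fun σ => decide ((∑ σ', P σ σ' * (if x σ' = true then (1 : ZMod 2) else 0)) = 1))
    dsimp only at hf
    simp only [hcell]
    rw [h3]
    exact hf
  exact HL h hk h1 κ' hκ'3 c' d' hcs' hcc' hcd' hds' hdc' hdd'' hd'T hpair' hD0' hF1' hsum' i j hij hmin' hpos' hwt' bz hsupp' hT'

end Summit.QuantumAdvantage.QuantumAdvantage.Theorems.CubicForrelation.NearExactIsExact
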